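import Literature.NumberTheory.LFunctions.VerticalArithmeticProgressionsOfZeros
import Literature.NumberTheory.LFunctions.ZetaFractionalPartIntegral
import Mathlib.Analysis.Fourier.AddCircle
import Mathlib.MeasureTheory.Function.JacobianOneDim
import Mathlib.MeasureTheory.Integral.IntegralEqImproper
import Mathlib.Analysis.Normed.Group.Tannery
import HarnessLib

/-!
# No infinite vertical arithmetic progressions of zeta zeros — proof (Putnam 1954)

LINE 1 — LABEL: RH-FREE literature (location of zeros of `ζ` off vertical lattices; no density,
no critical line). WHAT THIS IS NOT: nothing here bears on the truth of RH — Putnam's theorem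
constrains no zero's real part.

This file DISCHARGES the named fact
`Literature.NumberTheory.LFunctions.LapidusVanFrankenhuijsen2006_thm11_1`
(`VerticalArithmeticProgressionsOfZeros.lean`): for `0 < D < 1` and `p > 0` there is an integer
`n ≠ 0` with `ζ(D + inp) ≠ 0` — Lapidus–van Frankenhuijsen, *Fractal Geometry, Complex Dimensions
and Zeta Functions* (2006), Theorem 11.1, originally C. R. Putnam, Amer. J. Math. 76 (1954) 97–99.

## The proof followed (Putnam's Fourier-series argument, not the book's explicit-formula proof)

Suppose `ζ(s_n) = 0` for all `n ≠ 0`, `s_n = D + inp`, and put `L = 2π/p`.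
* Titchmarsh (2.1.4), in the tree as `riemannZeta_eq_of_re_pos`
  (`ZetaFractionalPartIntegral.lean`): `ζ(s) = s/(s-1) - s ∫_1^∞ {u}u^{-s-1} du` on `Re s > 0`;
  so at each zero `∫_1^∞ {u} u^{-s_n-1} du = 1/(s_n - 1)`, and after `u = e^y`
  (`fractIntegral_eq_integral_exp`) `∫_0^∞ {e^y} e^{-Dy} e^{-inpy} dy = 1/(s_n - 1)`.
* The translates-sum `Φ(x) = Σ_{k ≥ 0} g(x + kL)` of `g(y) = 𝟙_{y>0}{e^y}e^{-Dy}` has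
  `∫_{-L/2}^{L/2} e^{-inpx} Φ = ∫_0^∞ e^{-inpy} g` (unrolling the translates tiles `(-L/2, ∞)`;
  `integral_cexp_mul_phi`), while the explicit `Ψ(x) = e^{(1-D)x}(𝟙_{x≤0} + C₁)`,
  `C₁ = 1/(e^{(1-D)L} - 1)`, has `∫_{-L/2}^{L/2} e^{-inpx} Ψ = 1/(1 - D - inp) = -1/(s_n - 1)`
  (`integral_cexp_mul_psi`). Hence every non-constant Fourier coefficient of `Φ + Ψ` on the
  period interval vanishes and, by Parseval on an interval (Mathlib `tsum_sq_fourierCoeffOn`),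
  `Φ + Ψ` is a.e. constant there (`ae_eq_const`).
* But `Ψ` jumps by `-1` at `0`, whereas `Φ` cannot jump upwards: between consecutive jumps the
  sawtooth satisfies `{u} - {v} ≤ u - v` (`v ≤ u`), which gives `Φ(x) - Φ(y) → 0⁺`-bounded for
  `y < 0 < x`, `x - y → 0` (`g_translate_sub_le`, Tannery's theorem for the tail); picking
  a.e.-good points on both sides of `0` is a contradiction (`not_ae_eq_const`). (Putnam phrases the
  endgame with one-sided limits of the Fourier series; the a.e.-points form used here needs no
  pointwise convergence.)

Main result: `LapidusVanFrankenhuijsen2006_thm11_1_holds`. Helper lemmas live in the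
sub-namespace `Putnam1954`. No definitions, no new named facts.

## References

* C. R. Putnam, *On the non-periodicity of the zeros of the Riemann zeta-function*, Amer. J.
  Math. 76 (1954) 97–99. [Putnam1954]
* M. L. Lapidus, M. van Frankenhuijsen, *Fractal Geometry, Complex Dimensions and Zeta
  Functions*, Springer (2006), Theorem 11.1. [LapidusVanfrankenhuijsen2006]
* E. C. Titchmarsh, *The Theory of the Riemann Zeta-Function*, 2nd ed. (1986), (2.1.4).
  [Titchmarsh1986]
-/

noncomputable section

open Complex Real Set MeasureTheory Filter Topology intervalIntegral

namespace Literature.NumberTheory.LFunctions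

namespace Putnam1954

/-- `e^{iπn} = e^{-iπn}` for an integer `n`. [folklore] -/
private theorem cexp_pi_mul_int (n : ℤ) : cexp (π * I * n) = cexp (-(π * I * n)) := by
  rw [Complex.exp_eq_exp_iff_exists_int]
  exact ⟨n, by ring⟩

/-- The characters of `AddCircle (2π/p)` along `ℝ`: `fourier (-n) x = e^{-inpx}`. [folklore] -/
private theorem fourier_neg_coe {p : ℝ} (hp : 0 < p) (n : ℤ) (x : ℝ) :
    fourier (-n) (x : AddCircle (π / p - -(π / p))) = cexp (-(I * n * p * x)) := by
  rw [fourier_coe_apply]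
  congr 1
  have hp' : (p : ℂ) ≠ 0 := by exact_mod_cast hp.ne'
  have hπ : (π : ℂ) ≠ 0 := by exact_mod_cast Real.pi_ne_zero
  push_cast
  field_simp
  ring

/-- `∫_{-π/p}^{π/p} e^{-inpx} dx = 0` for `n ≠ 0`. [folklore] -/
private theorem integral_cexp_eq_zero {p : ℝ} (hp : 0 < p) {n : ℤ} (hn : n ≠ 0) :
    ∫ x in (-(π / p))..(π / p), cexp (-(I * n * p * x)) = 0 := by
  have hc : (-(I * n * p) : ℂ) ≠ 0 := by
    have hp' : (p : ℂ) ≠ 0 := by exact_mod_cast hp.ne'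
    have hn' : (n : ℂ) ≠ 0 := by exact_mod_cast hn
    simp [hp', hn', I_ne_zero]
  have h := integral_exp_mul_complex (a := -(π / p)) (b := π / p) hc
  have h1 : (fun x : ℝ ↦ cexp (-(I * n * p) * x)) = fun x : ℝ ↦ cexp (-(I * n * p * x)) := by
    funext x; ring_nf
  rw [h1] at h
  rw [h]
  have hp' : (p : ℂ) ≠ 0 := by exact_mod_cast hp.ne'
  have e1 : (-(I * n * p) : ℂ) * ((π / p : ℝ) : ℂ) = -(π * I * n) := by
    push_cast; field_simp
  have e2 : (-(I * n * p) : ℂ) * ((-(π / p) : ℝ) : ℂ) = π * I * n := by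
    push_cast; field_simp
  rw [e1, e2, ← cexp_pi_mul_int n, sub_self, zero_div]

/-- **The explicit exponential part.** For `0 < D < 1`, `p > 0`, `L = 2π/p` and
`C₁ = 1/(e^{(1-D)L} - 1)`, the function `Ψ(x) = e^{(1-D)x}(𝟙_{x ≤ 0} + C₁)` has
`∫_{-L/2}^{L/2} e^{-inpx} Ψ(x) dx = 1/(1 - D - inp)` for every integer `n`. [folklore] -/
private theorem integral_cexp_mul_psi {D p : ℝ} (hD1 : D < 1) (hp : 0 < p) {Ψ : ℝ → ℝ}
    (hΨ : ∀ x, Ψ x = rexp ((1 - D) * x) *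
      ((if x ≤ 0 then 1 else 0) + 1 / (rexp ((1 - D) * (2 * π / p)) - 1))) (n : ℤ) :
    ∫ x in (-(π / p))..(π / p), cexp (-(I * n * p * x)) * (Ψ x : ℂ) =
      1 / (1 - D - I * n * p) := by
  set w : ℂ := 1 - (D : ℂ) - I * n * p with hw
  have hwre : w.re = 1 - D := by simp [hw]
  have hw0 : w ≠ 0 := by
    intro h; have := congrArg Complex.re h; rw [hwre] at this; simp at this; linarith
  set b : ℝ := π / p with hb
  have hb0 : 0 < b := div_pos Real.pi_pos hp
  set C₁ : ℝ := 1 / (rexp ((1 - D) * (2 * π / p)) - 1) with hC₁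
  -- the integrand as `e^{wx}(𝟙 + C₁)`
  have hint : ∀ x : ℝ, cexp (-(I * n * p * x)) * (Ψ x : ℂ) =
      cexp (w * x) * ((if x ≤ 0 then 1 else 0 : ℝ) : ℂ) + (C₁ : ℂ) * cexp (w * x) := by
    intro x
    have e : ((rexp ((1 - D) * x) : ℝ) : ℂ) = cexp (w * x) * cexp (I * n * p * x) := by
      rw [Complex.ofReal_exp, ← Complex.exp_add]; congr 1; rw [hw]; push_cast; ring
    have e2 : cexp (-(I * n * p * x)) * cexp (I * n * p * x) = 1 := by
      rw [← Complex.exp_add, neg_add_cancel, Complex.exp_zero]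
    rw [hΨ x, Complex.ofReal_mul, Complex.ofReal_add, e]
    linear_combination (cexp (w * x) * (((if x ≤ 0 then 1 else 0 : ℝ) : ℂ) + C₁)) * e2
  simp_rw [hint]
  have hcont : Continuous fun x : ℝ ↦ cexp (w * x) := by fun_prop
  -- integrability of the two pieces
  have hi1 : IntervalIntegrable (fun x : ℝ ↦ cexp (w * x) * ((if x ≤ 0 then 1 else 0 : ℝ) : ℂ))
      volume (-b) b := by
    have hc' := hcont.intervalIntegrable (μ := volume) (-b) b
    rw [intervalIntegrable_iff] at hc' ⊢
    refine hc'.mul_bdd (c := 1) ?_ (ae_of_all _ fun x ↦ ?_)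
    · exact (Complex.measurable_ofReal.comp
        (Measurable.ite measurableSet_Iic measurable_const measurable_const)).aestronglyMeasurable
    · split_ifs <;> simp
  have hi2 : IntervalIntegrable (fun x : ℝ ↦ (C₁ : ℂ) * cexp (w * x)) volume (-b) b :=
    (hcont.const_mul _).intervalIntegrable _ _
  rw [intervalIntegral.integral_add hi1 hi2, intervalIntegral.integral_const_mul,
    integral_exp_mul_complex hw0]
  -- the indicator piece: split at `0`
  have hsplit : ∫ x in (-b)..b, cexp (w * x) * ((if x ≤ 0 then 1 else 0 : ℝ) : ℂ) =
      ∫ x in (-b)..0, cexp (w * x) := by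
    rw [← intervalIntegral.integral_add_adjacent_intervals (b := 0)
      (hi1.mono_set (by
        rw [uIcc_of_le (by linarith), uIcc_of_le (by linarith)]
        exact Icc_subset_Icc le_rfl hb0.le))
      (hi1.mono_set (by
        rw [uIcc_of_le hb0.le, uIcc_of_le (by linarith)]
        exact Icc_subset_Icc (by linarith) le_rfl))]
    have h1 : ∫ x in (-b)..0, cexp (w * x) * ((if x ≤ 0 then 1 else 0 : ℝ) : ℂ) =
        ∫ x in (-b)..0, cexp (w * x) := by
      refine intervalIntegral.integral_congr_ae (ae_of_all _ fun x hx ↦ ?_)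
      rw [uIoc_of_le (by linarith)] at hx
      rw [if_pos hx.2]; simp
    have h2 : ∫ x in (0:ℝ)..b, cexp (w * x) * ((if x ≤ 0 then 1 else 0 : ℝ) : ℂ) = 0 := by
      have : ∫ x in (0:ℝ)..b, cexp (w * x) * ((if x ≤ 0 then 1 else 0 : ℝ) : ℂ) =
          ∫ x in (0:ℝ)..b, (0 : ℂ) := by
        refine intervalIntegral.integral_congr_ae (ae_of_all _ fun x hx ↦ ?_)
        rw [uIoc_of_le hb0.le] at hx
        rw [if_neg (not_le.mpr hx.1)]; simp
      rw [this, intervalIntegral.integral_zero]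
    rw [h1, h2, add_zero]
  rw [hsplit, integral_exp_mul_complex hw0]
  -- evaluate the exponentials: `e^{wb} = ρ ω`, `e^{-wb} = ρ⁻¹ ω`, `ω = e^{-iπn} = e^{iπn}`
  set ρ : ℝ := rexp ((1 - D) * b) with hρ
  have hρpos : 0 < ρ := Real.exp_pos _
  have hwb : cexp (w * (b : ℝ)) = (ρ : ℂ) * cexp (-(π * I * n)) := by
    rw [hρ, Complex.ofReal_exp, ← Complex.exp_add]; congr 1
    rw [hw, hb]; push_cast
    have hp' : (p : ℂ) ≠ 0 := by exact_mod_cast hp.ne'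
    field_simp; ring
  have hwa : cexp (w * ((-b : ℝ) : ℂ)) = (ρ : ℂ)⁻¹ * cexp (π * I * n) := by
    rw [hρ, Complex.ofReal_exp, ← Complex.exp_neg, ← Complex.exp_add]; congr 1
    rw [hw, hb]; push_cast
    have hp' : (p : ℂ) ≠ 0 := by exact_mod_cast hp.ne'
    field_simp; ring
  have hC₁' : (C₁ : ℂ) = 1 / ((ρ : ℂ) ^ 2 - 1) := by
    rw [hC₁, hρ]; push_cast
    rw [← Complex.exp_nat_mul]; congr 2
    rw [hb]; push_cast; ring
  have hρ21 : (ρ : ℂ) ^ 2 - 1 ≠ 0 := by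
    have h1 : 1 < ρ := by
      rw [hρ]; exact Real.one_lt_exp_iff.mpr (mul_pos (by linarith) hb0)
    have h2 : (1 : ℝ) < ρ ^ 2 := by nlinarith
    have : ((ρ ^ 2 - 1 : ℝ) : ℂ) ≠ 0 := by exact_mod_cast (by linarith : ρ ^ 2 - 1 ≠ 0)
    simpa using this
  rw [Complex.ofReal_zero, mul_zero, Complex.exp_zero, hwb, hwa, hC₁', ← cexp_pi_mul_int n]
  set ω : ℂ := cexp (π * I * n) with hω
  have hρ0 : (ρ : ℂ) ≠ 0 := by exact_mod_cast hρpos.ne'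
  field_simp
  ring

/-! ### The sawtooth part `g(y) = 𝟙_{y>0} {e^y} e^{-Dy}` and its translates-sum `Φ` -/

/-- `g ≥ 0`. [folklore] -/
private theorem g_nonneg {D : ℝ} {g : ℝ → ℝ}
    (hg : ∀ y, g y = if 0 < y then Int.fract (rexp y) * rexp (-(D * y)) else 0) (y : ℝ) :
    0 ≤ g y := by
  rw [hg]; split_ifs
  · exact mul_nonneg (Int.fract_nonneg _) (Real.exp_pos _).le
  · exact le_rfl

/-- `g(y) ≤ e^{-Dy}`. [folklore] -/
private theorem g_le {D : ℝ} {g : ℝ → ℝ}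
    (hg : ∀ y, g y = if 0 < y then Int.fract (rexp y) * rexp (-(D * y)) else 0) (y : ℝ) :
    g y ≤ rexp (-(D * y)) := by
  rw [hg]; split_ifs
  · exact mul_le_of_le_one_left (Real.exp_pos _).le (Int.fract_lt_one _).le
  · exact (Real.exp_pos _).le

/-- `g` is measurable. [folklore] -/
private theorem measurable_g {D : ℝ} {g : ℝ → ℝ}
    (hg : ∀ y, g y = if 0 < y then Int.fract (rexp y) * rexp (-(D * y)) else 0) :
    Measurable g := by
  rw [show g = fun y ↦ if 0 < y then Int.fract (rexp y) * rexp (-(D * y)) else 0 from funext hg]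
  refine Measurable.ite measurableSet_Ioi ?_ measurable_const
  exact (measurable_fract.comp Real.measurable_exp).mul (by fun_prop)

/-- Geometric decay of the translates: `g(x + kL) ≤ e^{-Dx} (e^{-DL})^k`. [folklore] -/
private theorem g_translate_le {D L : ℝ} {g : ℝ → ℝ}
    (hg : ∀ y, g y = if 0 < y then Int.fract (rexp y) * rexp (-(D * y)) else 0)
    (x : ℝ) (k : ℕ) :
    g (x + k * L) ≤ rexp (-(D * x)) * rexp (-(D * L)) ^ k := by
  refine (g_le hg _).trans_eq ?_
  rw [← Real.exp_nat_mul, ← Real.exp_add]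
  congr 1; ring

/-- The translates `k ↦ g(x + kL)` are summable (geometric majorant). [folklore] -/
private theorem summable_g_translate {D L : ℝ} (hD : 0 < D) (hL : 0 < L) {g : ℝ → ℝ}
    (hg : ∀ y, g y = if 0 < y then Int.fract (rexp y) * rexp (-(D * y)) else 0) (x : ℝ) :
    Summable fun k : ℕ ↦ g (x + k * L) := by
  have hr : rexp (-(D * L)) < 1 := Real.exp_lt_one_iff.mpr (by nlinarith)
  refine Summable.of_nonneg_of_le (fun k ↦ g_nonneg hg _) (fun k ↦ g_translate_le hg x k) ?_
  exact (summable_geometric_of_lt_one (Real.exp_pos _).le hr).mul_left _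

/-- The translates-sum `Φ(x) = Σ_{k ≥ 0} g(x + 2bk)` is measurable (pointwise limit of the
partial sums). [folklore] -/
private theorem measurable_phi {D p : ℝ} (hD : 0 < D) (hp : 0 < p) {g : ℝ → ℝ}
    (hg : ∀ y, g y = if 0 < y then Int.fract (rexp y) * rexp (-(D * y)) else 0) {Φ : ℝ → ℝ}
    (hΦ : ∀ x, Φ x = ∑' k : ℕ, g (x + k * (2 * π / p))) : Measurable Φ := by
  have hb0 : 0 < π / p := div_pos Real.pi_pos hp
  have hL : 2 * π / p = 2 * (π / p) := by ring
  rw [show Φ = fun x ↦ ∑' k : ℕ, g (x + k * (2 * π / p)) from funext hΦ, hL]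
  refine measurable_of_tendsto_metrizable
    (f := fun N x ↦ ∑ k ∈ Finset.range N, g (x + k * (2 * (π / p)))) (fun N ↦ ?_) ?_
  · exact Finset.measurable_sum _ fun k _ ↦ (measurable_g hg).comp (measurable_id.add_const _)
  · exact tendsto_pi_nhds.mpr fun x ↦ (summable_g_translate hD (by positivity) hg x).hasSum.tendsto_sum_nat

/-- Bounds for the translates-sum: `0 ≤ Φ(x) ≤ e^{-Dx}/(1 - e^{-2Db})`. [folklore] -/
private theorem phi_nonneg_le {D p : ℝ} (hD : 0 < D) (hp : 0 < p) {g : ℝ → ℝ}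
    (hg : ∀ y, g y = if 0 < y then Int.fract (rexp y) * rexp (-(D * y)) else 0) {Φ : ℝ → ℝ}
    (hΦ : ∀ x, Φ x = ∑' k : ℕ, g (x + k * (2 * π / p))) (x : ℝ) :
    0 ≤ Φ x ∧ Φ x ≤ rexp (-(D * x)) * (1 - rexp (-(D * (2 * (π / p)))))⁻¹ := by
  have hb0 : 0 < π / p := div_pos Real.pi_pos hp
  have hL : 2 * π / p = 2 * (π / p) := by ring
  have hr0 : 0 ≤ rexp (-(D * (2 * (π / p)))) := (Real.exp_pos _).le
  have hr1 : rexp (-(D * (2 * (π / p)))) < 1 := Real.exp_lt_one_iff.mpr (by nlinarith)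
  rw [hΦ x, hL]
  refine ⟨tsum_nonneg fun k ↦ g_nonneg hg _, ?_⟩
  rw [← tsum_geometric_of_lt_one hr0 hr1, ← tsum_mul_left]
  exact (summable_g_translate hD (by positivity) hg x).tsum_le_tsum (fun k ↦ g_translate_le hg x k)
    ((summable_geometric_of_lt_one hr0 hr1).mul_left _)

/-- **Mellin form of the fractional-part integral**: for every `s`,
`∫_1^∞ {u} u^{-s-1} du = ∫_0^∞ {e^y} e^{-sy} dy` (`u = e^y`). [folklore] -/
private theorem fractIntegral_eq_integral_exp (s : ℂ) :
    fractIntegral s = ∫ y in Ioi (0:ℝ), ((Int.fract (rexp y) : ℝ) : ℂ) * cexp (-(s * y)) := by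
  rw [fractIntegral_def, show Ioi (1:ℝ) = rexp '' Ioi 0 by rw [Real.image_exp_Ioi, Real.exp_zero],
    integral_image_eq_integral_abs_deriv_smul measurableSet_Ioi
      (fun x _ ↦ (Real.hasDerivAt_exp x).hasDerivWithinAt) Real.exp_injective.injOn]
  refine setIntegral_congr_fun measurableSet_Ioi fun y _ ↦ ?_
  have hey : (0:ℝ) < rexp y := Real.exp_pos y
  have hcpow : ((rexp y : ℝ) : ℂ) ^ (-(s + 1)) = cexp (-(s + 1) * y) := by
    rw [Complex.cpow_def_of_ne_zero (by exact_mod_cast hey.ne'), ← Complex.ofReal_log hey.le,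
      Real.log_exp, mul_comm]
  rw [abs_of_pos hey, hcpow, Complex.real_smul, Complex.ofReal_exp,
    show cexp (-(s * y)) = cexp y * cexp (-(s + 1) * y) by
      rw [← Complex.exp_add]; ring_nf]
  ring

/-- **Fourier coefficients of the translates-sum.** With `b = π/p`, `L = 2b` and
`Φ(x) = Σ_{k≥0} g(x + kL)`: `∫_{-b}^{b} e^{-inpx} Φ(x) dx = ∫_1^∞ {u}u^{-s_n-1} du`,
`s_n = D + inp`. (Unrolling the translates tiles `(-b, ∞)`; `g` vanishes on `(-b, 0]`;
then `u = e^y`.) [folklore] -/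
private theorem integral_cexp_mul_phi {D p : ℝ} (hD : 0 < D) (hp : 0 < p) {g : ℝ → ℝ}
    (hg : ∀ y, g y = if 0 < y then Int.fract (rexp y) * rexp (-(D * y)) else 0) {Φ : ℝ → ℝ}
    (hΦ : ∀ x, Φ x = ∑' k : ℕ, g (x + k * (2 * π / p))) (n : ℤ) :
    ∫ x in (-(π / p))..(π / p), cexp (-(I * n * p * x)) * (Φ x : ℂ) =
      fractIntegral (D + I * n * p) := by
  set b : ℝ := π / p with hb
  have hb0 : 0 < b := div_pos Real.pi_pos hp
  have hL : 2 * π / p = 2 * b := by rw [hb]; ring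
  set s : ℂ := D + I * n * p with hs
  set e : ℝ → ℂ := fun x ↦ cexp (-(I * n * p * x)) with he
  have he_norm : ∀ x, ‖e x‖ = 1 := fun x ↦ by
    rw [he]; dsimp only
    rw [Complex.norm_exp]; simp
  have he_cont : Continuous e := by rw [he]; fun_prop
  have he_per : ∀ (x : ℝ) (k : ℕ), e (x + k * (2 * b)) = e x := by
    intro x k
    rw [he]; dsimp only
    have h2 : -(I * n * p * ((x + k * (2 * b) : ℝ) : ℂ)) =
        -(I * n * p * x) + ((-(n * k : ℤ)) : ℤ) * (2 * π * I) := by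
      rw [hb]; push_cast
      have hp' : (p : ℂ) ≠ 0 := by exact_mod_cast hp.ne'
      field_simp; ring
    rw [h2, Complex.exp_add, Complex.exp_int_mul_two_pi_mul_I, mul_one]
  set r : ℝ := rexp (-(D * (2 * b))) with hr
  have hr0 : 0 ≤ r := (Real.exp_pos _).le
  have hr1 : r < 1 := Real.exp_lt_one_iff.mpr (by nlinarith)
  have hgm : Measurable g := measurable_g hg
  -- the terms `F k x = e(x) g(x + kL)` and their integrals
  set F : ℕ → ℝ → ℂ := fun k x ↦ e x * (g (x + k * (2 * b)) : ℂ) with hF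
  have hF_meas : ∀ k, Measurable (F k) := fun k ↦ by
    rw [hF]
    exact he_cont.measurable.mul
      (Complex.measurable_ofReal.comp (hgm.comp (measurable_id.add_const _)))
  have hF_norm : ∀ k x, -b ≤ x → ‖F k x‖ ≤ rexp (D * b) * r ^ k := fun k x hx ↦ by
    rw [hF]; dsimp only
    rw [norm_mul, he_norm, one_mul, Complex.norm_real, Real.norm_eq_abs,
      abs_of_nonneg (g_nonneg hg _)]
    refine (g_translate_le hg x k).trans ?_
    gcongr
    nlinarith
  haveI hfin : IsFiniteMeasure (volume.restrict (Ioc (-b) b)) :=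
    isFiniteMeasure_restrict.mpr measure_Ioc_lt_top.ne
  have hF_int : ∀ k, Integrable (F k) (volume.restrict (Ioc (-b) b)) := fun k ↦ by
    refine Integrable.mono' (integrable_const (rexp (D * b) * r ^ k))
      (hF_meas k).aestronglyMeasurable ?_
    rw [ae_restrict_iff' measurableSet_Ioc]
    exact ae_of_all _ fun x hx ↦ hF_norm k x hx.1.le
  have hvol : volume.real (Ioc (-b) b) = 2 * b := by
    rw [measureReal_def, Real.volume_Ioc, ENNReal.toReal_ofReal (by linarith)]; ring
  have hF_sum : Summable fun k ↦ ∫ x in Ioc (-b) b, ‖F k x‖ := by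
    refine Summable.of_nonneg_of_le (fun k ↦ integral_nonneg fun x ↦ norm_nonneg _)
      (fun k ↦ ?_) ((summable_geometric_of_lt_one hr0 hr1).mul_left (rexp (D * b) * (2 * b)))
    calc ∫ x in Ioc (-b) b, ‖F k x‖ ≤ ∫ x in Ioc (-b) b, rexp (D * b) * r ^ k := by
          refine setIntegral_mono_on (hF_int k).norm (integrableOn_const ?_) measurableSet_Ioc
            fun x hx ↦ hF_norm k x hx.1.le
          exact measure_Ioc_lt_top.ne
      _ = rexp (D * b) * (2 * b) * r ^ k := by
          rw [setIntegral_const, hvol, smul_eq_mul]; ring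
  -- Step 1: interchange sum and integral
  have step1 : ∫ x in (-b)..b, e x * (Φ x : ℂ) = ∑' k, ∫ x in (-b)..b, F k x := by
    simp_rw [intervalIntegral.integral_of_le (by linarith : -b ≤ b)]
    rw [integral_tsum_of_summable_integral_norm hF_int hF_sum]
    refine setIntegral_congr_fun measurableSet_Ioc fun x _ ↦ ?_
    rw [hΦ x, hL, Complex.ofReal_tsum, ← tsum_mul_left]
  -- Step 2: each term is the integral of `e g` over the translated interval
  have step2 : ∀ k : ℕ, ∫ x in (-b)..b, F k x =
      ∫ y in (-b + k * (2 * b))..(-b + (k + 1 : ℕ) * (2 * b)), e y * (g y : ℂ) := by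
    intro k
    have h := intervalIntegral.integral_comp_add_right (a := -b) (b := b)
      (fun y ↦ e y * (g y : ℂ)) (k * (2 * b))
    rw [show b + k * (2 * b) = -b + (k + 1 : ℕ) * (2 * b) by push_cast; ring] at h
    rw [← h]
    refine intervalIntegral.integral_congr fun x _ ↦ ?_
    show e x * (g (x + k * (2 * b)) : ℂ) = e (x + k * (2 * b)) * (g (x + k * (2 * b)) : ℂ)
    rw [he_per]
  -- Step 3: the translated intervals tile `(-b, ∞)`
  have heg_int : IntegrableOn (fun y ↦ e y * (g y : ℂ)) (Ioi (-b)) := by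
    refine Integrable.mono' ((exp_neg_integrableOn_Ioi (-b) hD)) ?_ ?_
    · exact (he_cont.measurable.mul (Complex.measurable_ofReal.comp hgm)).aestronglyMeasurable
    · refine ae_of_all _ fun y ↦ ?_
      rw [norm_mul, he_norm, one_mul, Complex.norm_real, Real.norm_eq_abs,
        abs_of_nonneg (g_nonneg hg _)]
      simpa [neg_mul] using g_le hg y
  have step3 : ∑' k : ℕ, ∫ y in (-b + k * (2 * b))..(-b + (k + 1 : ℕ) * (2 * b)), e y * (g y : ℂ) =
      ∫ y in Ioi (-b), e y * (g y : ℂ) := by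
    have hpartial : ∀ N : ℕ, ∑ k ∈ Finset.range N,
        ∫ y in (-b + k * (2 * b))..(-b + (k + 1 : ℕ) * (2 * b)), e y * (g y : ℂ) =
        ∫ y in (-b)..(-b + (N : ℕ) * (2 * b)), e y * (g y : ℂ) := by
      intro N
      have hii : ∀ k < N, IntervalIntegrable (fun y ↦ e y * (g y : ℂ)) volume
          ((fun k : ℕ ↦ -b + k * (2 * b)) k) ((fun k : ℕ ↦ -b + k * (2 * b)) (k + 1)) := by
        intro k _
        have hle : -b + (k : ℝ) * (2 * b) ≤ -b + ((k + 1 : ℕ) : ℝ) * (2 * b) := by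
          push_cast; nlinarith
        refine intervalIntegrable_iff.mpr (heg_int.mono_set ?_)
        rw [uIoc_of_le hle]
        refine fun y hy ↦ lt_of_le_of_lt ?_ hy.1
        have : (0:ℝ) ≤ (k : ℝ) * (2 * b) := by positivity
        linarith
      have h := intervalIntegral.sum_integral_adjacent_intervals hii
      simpa using h
    have hJsum : Summable fun k : ℕ ↦
        ∫ y in (-b + k * (2 * b))..(-b + (k + 1 : ℕ) * (2 * b)), e y * (g y : ℂ) := by
      have : ∀ k : ℕ, ∫ y in (-b + k * (2 * b))..(-b + (k + 1 : ℕ) * (2 * b)), e y * (g y : ℂ) =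
          ∫ x in (-b)..b, F k x := fun k ↦ (step2 k).symm
      simp_rw [this, intervalIntegral.integral_of_le (by linarith : -b ≤ b)]
      exact Summable.of_norm_bounded hF_sum fun k ↦ norm_integral_le_integral_norm _
    have htend : Tendsto (fun N : ℕ ↦ ∑ k ∈ Finset.range N,
        ∫ y in (-b + k * (2 * b))..(-b + (k + 1 : ℕ) * (2 * b)), e y * (g y : ℂ)) atTop
        (𝓝 (∫ y in Ioi (-b), e y * (g y : ℂ))) := by
      simp_rw [hpartial]
      refine intervalIntegral_tendsto_integral_Ioi (-b) heg_int ?_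
      refine tendsto_atTop_add_const_left _ _ ?_
      exact tendsto_natCast_atTop_atTop.atTop_mul_const (by linarith)
    exact tendsto_nhds_unique hJsum.hasSum.tendsto_sum_nat htend
  -- Step 4: `g` vanishes on `(-b, 0]`, and on `(0, ∞)` the integrand is `{e^y} e^{-s y}`
  have step4 : ∫ y in Ioi (-b), e y * (g y : ℂ) =
      ∫ y in Ioi (0:ℝ), ((Int.fract (rexp y) : ℝ) : ℂ) * cexp (-(s * y)) := by
    rw [← Ioc_union_Ioi_eq_Ioi (by linarith : -b ≤ 0),
      setIntegral_union (Set.Ioc_disjoint_Ioi le_rfl) measurableSet_Ioi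
        (heg_int.mono_set Ioc_subset_Ioi_self) (heg_int.mono_set (Ioi_subset_Ioi (by linarith))),
      setIntegral_eq_zero_of_forall_eq_zero fun y hy ↦ by
        rw [hg y, if_neg (not_lt.mpr hy.2)]; simp, zero_add]
    refine setIntegral_congr_fun measurableSet_Ioi fun y hy ↦ ?_
    rw [hg y, if_pos (mem_Ioi.mp hy), he]
    dsimp only
    push_cast
    rw [show cexp (-(s * y)) = cexp (-(I * n * p * y)) * cexp (-((D : ℂ) * y)) by
      rw [← Complex.exp_add]; congr 1; rw [hs]; ring]
    ring
  rw [step1]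
  simp_rw [step2]
  rw [step3, step4, ← fractIntegral_eq_integral_exp]

/-! ### The explicit part `Ψ`: measurability and bounds -/

/-- `Ψ` is measurable. [folklore] -/
private theorem measurable_psi {D p : ℝ} {Ψ : ℝ → ℝ}
    (hΨ : ∀ x, Ψ x = rexp ((1 - D) * x) *
      ((if x ≤ 0 then 1 else 0) + 1 / (rexp ((1 - D) * (2 * π / p)) - 1))) :
    Measurable Ψ := by
  rw [show Ψ = _ from funext hΨ]
  refine Measurable.mul (by fun_prop) ?_
  exact (Measurable.ite measurableSet_Iic measurable_const measurable_const).add_const _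

/-- `C₁ = 1/(e^{(1-D)L} - 1) > 0`. [folklore] -/
private theorem C₁_pos {D p : ℝ} (hD1 : D < 1) (hp : 0 < p) :
    0 < 1 / (rexp ((1 - D) * (2 * π / p)) - 1) := by
  have : 1 < rexp ((1 - D) * (2 * π / p)) :=
    Real.one_lt_exp_iff.mpr (mul_pos (by linarith) (div_pos (by positivity) hp))
  exact div_pos one_pos (by linarith)

/-- `|Ψ| ≤ e^{(1-D)π/p}(1 + C₁)` on `(-∞, π/p]`. [folklore] -/
private theorem abs_psi_le {D p : ℝ} (hD1 : D < 1) (hp : 0 < p) {Ψ : ℝ → ℝ}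
    (hΨ : ∀ x, Ψ x = rexp ((1 - D) * x) *
      ((if x ≤ 0 then 1 else 0) + 1 / (rexp ((1 - D) * (2 * π / p)) - 1)))
    {x : ℝ} (hx : x ≤ π / p) :
    |Ψ x| ≤ rexp ((1 - D) * (π / p)) * (1 + 1 / (rexp ((1 - D) * (2 * π / p)) - 1)) := by
  have hC := C₁_pos hD1 hp
  rw [hΨ x, abs_mul, abs_of_pos (Real.exp_pos _), abs_of_nonneg (by split_ifs <;> linarith)]
  refine mul_le_mul (Real.exp_le_exp.mpr ?_) (by split_ifs <;> linarith)
    (by split_ifs <;> linarith) (Real.exp_pos _).le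
  nlinarith

/-! ### Vanishing Fourier coefficients and Parseval: `Φ + Ψ` is a.e. constant -/

/-- **Putnam's Fourier-series step.** If `ζ(D + inp) = 0` for every integer `n ≠ 0`
(`0 < D < 1`, `p > 0`), then `Φ + Ψ` has all non-constant Fourier coefficients on the period
interval `(-π/p, π/p]` equal to zero, hence (Parseval) is a.e. equal to a constant there.
[cite: Putnam1954, pp. 97–99; LapidusVanfrankenhuijsen2006, Theorem 11.1] -/
theorem ae_eq_const {D p : ℝ} (hD0 : 0 < D) (hD1 : D < 1) (hp : 0 < p) {g Φ Ψ : ℝ → ℝ}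
    (hg : ∀ y, g y = if 0 < y then Int.fract (rexp y) * rexp (-(D * y)) else 0)
    (hΦ : ∀ x, Φ x = ∑' k : ℕ, g (x + k * (2 * π / p)))
    (hΨ : ∀ x, Ψ x = rexp ((1 - D) * x) *
      ((if x ≤ 0 then 1 else 0) + 1 / (rexp ((1 - D) * (2 * π / p)) - 1)))
    (hzero : ∀ n : ℤ, n ≠ 0 → riemannZeta (D + I * n * p) = 0) :
    ∃ c : ℝ, ∀ᵐ x ∂(volume.restrict (Ioc (-(π / p)) (π / p))), Φ x + Ψ x = c := by
  have hb0 : 0 < π / p := div_pos Real.pi_pos hp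
  have hab : -(π / p) < π / p := by linarith
  have hΦm : Measurable Φ := measurable_phi hD0 hp hg hΦ
  have hΨm : Measurable Ψ := measurable_psi hΨ
  -- a uniform bound on the period interval
  obtain ⟨M, hM⟩ : ∃ M : ℝ, ∀ x ∈ Ioc (-(π / p)) (π / p), |Φ x| + |Ψ x| ≤ M := by
    refine ⟨rexp (D * (π / p)) * (1 - rexp (-(D * (2 * (π / p)))))⁻¹ +
      rexp ((1 - D) * (π / p)) * (1 + 1 / (rexp ((1 - D) * (2 * π / p)) - 1)), fun x hx ↦ ?_⟩
    have h1 := phi_nonneg_le hD0 hp hg hΦ x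
    have hr1 : rexp (-(D * (2 * (π / p)))) < 1 := Real.exp_lt_one_iff.mpr (by nlinarith)
    refine add_le_add ?_ (abs_psi_le hD1 hp hΨ hx.2)
    rw [abs_of_nonneg h1.1]
    refine h1.2.trans (mul_le_mul_of_nonneg_right (Real.exp_le_exp.mpr ?_)
      (inv_nonneg.mpr (by linarith)))
    have : 0 ≤ D * (x + π / p) := mul_nonneg hD0.le (by linarith [hx.1])
    linarith
  set Fc : ℝ → ℂ := fun x ↦ (Φ x : ℂ) + (Ψ x : ℂ) with hFc
  set c : ℂ := (1 / (2 * (π / p)) : ℝ) * ∫ x in (-(π / p))..(π / p), Fc x with hc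
  set F : ℝ → ℂ := fun x ↦ Fc x - c with hF
  have hFcm : Measurable Fc := by
    rw [hFc]; exact (Complex.measurable_ofReal.comp hΦm).add (Complex.measurable_ofReal.comp hΨm)
  have hFm : Measurable F := hFcm.sub_const c
  have hFc_bdd : ∀ x ∈ Ioc (-(π / p)) (π / p), ‖Fc x‖ ≤ M := fun x hx ↦ by
    rw [hFc]; dsimp only
    refine (norm_add_le _ _).trans ?_
    rw [Complex.norm_real, Complex.norm_real, Real.norm_eq_abs, Real.norm_eq_abs]
    exact hM x hx
  have hF_bdd : ∀ x ∈ Ioc (-(π / p)) (π / p), ‖F x‖ ≤ M + ‖c‖ := fun x hx ↦ by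
    rw [hF]; dsimp only
    exact (norm_sub_le _ _).trans (add_le_add (hFc_bdd x hx) le_rfl)
  haveI hfin : IsFiniteMeasure (volume.restrict (Ioc (-(π / p)) (π / p))) :=
    isFiniteMeasure_restrict.mpr measure_Ioc_lt_top.ne
  have hL2 : MemLp F 2 (volume.restrict (Ioc (-(π / p)) (π / p))) :=
    MemLp.of_bound hFm.aestronglyMeasurable (M + ‖c‖)
      (by rw [ae_restrict_iff' measurableSet_Ioc]; exact ae_of_all _ hF_bdd)
  -- interval integrability of the pieces against the characters
  have hii : ∀ (n : ℤ) {f : ℝ → ℝ}, Measurable f → (∀ x ∈ Ioc (-(π / p)) (π / p), |f x| ≤ M) →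
      IntervalIntegrable (fun x ↦ cexp (-(I * n * p * x)) * (f x : ℂ)) volume (-(π / p)) (π / p) := by
    intro n f hfm hfb
    rw [intervalIntegrable_iff, uIoc_of_le hab.le]
    refine Integrable.mono' (integrable_const M) ?_ ?_
    · exact ((by fun_prop : Continuous fun x : ℝ ↦ cexp (-(I * n * p * x))).measurable.mul
        (Complex.measurable_ofReal.comp hfm)).aestronglyMeasurable
    · rw [ae_restrict_iff' measurableSet_Ioc]
      refine ae_of_all _ fun x hx ↦ ?_
      rw [norm_mul, Complex.norm_exp, Complex.norm_real, Real.norm_eq_abs]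
      simp only [neg_re, mul_re, I_re, zero_mul, I_im, one_mul, intCast_re,
        ofReal_re, intCast_im, ofReal_im, mul_zero, sub_zero, mul_im,
        neg_zero, Real.exp_zero]
      exact hfb x hx
  have hMΦ : ∀ x ∈ Ioc (-(π / p)) (π / p), |Φ x| ≤ M := fun x hx ↦
    le_trans (le_add_of_nonneg_right (abs_nonneg _)) (hM x hx)
  have hMΨ : ∀ x ∈ Ioc (-(π / p)) (π / p), |Ψ x| ≤ M := fun x hx ↦
    le_trans (le_add_of_nonneg_left (abs_nonneg _)) (hM x hx)
  -- all Fourier coefficients of `F` on the period interval vanish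
  have hcoeff : ∀ n : ℤ, fourierCoeffOn hab F n = 0 := by
    intro n
    rw [fourierCoeffOn_eq_integral, smul_eq_zero]
    refine Or.inr ?_
    have hchar : ∀ x : ℝ, fourier (-n) (x : AddCircle (π / p - -(π / p))) • F x =
        cexp (-(I * n * p * x)) * (Φ x : ℂ) + cexp (-(I * n * p * x)) * (Ψ x : ℂ) -
          c * cexp (-(I * n * p * x)) := by
      intro x
      rw [fourier_neg_coe hp, smul_eq_mul, hF, hFc]
      ring
    simp_rw [hchar]
    rw [intervalIntegral.integral_sub ((hii n hΦm hMΦ).add (hii n hΨm hMΨ))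
        ((Continuous.intervalIntegrable (by fun_prop) _ _).const_mul c),
      intervalIntegral.integral_add (hii n hΦm hMΦ) (hii n hΨm hMΨ),
      intervalIntegral.integral_const_mul]
    by_cases hn : n = 0
    · -- the constant term: this is the choice of `c`
      subst hn
      have h1 : ∀ x : ℝ, cexp (-(I * ((0 : ℤ) : ℂ) * p * x)) = 1 := fun x ↦ by simp
      simp only [h1, one_mul, intervalIntegral.integral_const, Complex.real_smul, mul_one]
      have hI : (∫ x in (-(π / p))..(π / p), (Φ x : ℂ)) + ∫ x in (-(π / p))..(π / p), (Ψ x : ℂ) =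
          ∫ x in (-(π / p))..(π / p), Fc x := by
        rw [← intervalIntegral.integral_add]
        · simpa [h1] using hii 0 hΦm hMΦ
        · simpa [h1] using hii 0 hΨm hMΨ
      rw [hI, hc]
      have hp' : (p : ℂ) ≠ 0 := by exact_mod_cast hp.ne'
      have hπ : (π : ℂ) ≠ 0 := by exact_mod_cast Real.pi_ne_zero
      push_cast
      field_simp
      ring
    · -- `n ≠ 0`: the two computed coefficients cancel at a zero of `ζ`
      rw [integral_cexp_mul_phi hD0 hp hg hΦ n, integral_cexp_mul_psi hD1 hp hΨ n,
        integral_cexp_eq_zero hp hn, mul_zero, sub_zero]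
      set s : ℂ := D + I * n * p with hs
      have hsre : s.re = D := by simp [hs]
      have hs0 : s ≠ 0 := fun h ↦ by
        have := congrArg Complex.re h; rw [hsre] at this; simp at this; linarith
      have hs1 : s ≠ 1 := fun h ↦ by
        have := congrArg Complex.re h; rw [hsre] at this; simp at this; linarith
      have hz := riemannZeta_eq_of_re_pos (s := s) (by rw [hsre]; exact hD0) hs1
      rw [hzero n hn] at hz
      have hfi : fractIntegral s = 1 / (s - 1) := by
        have hs1' : s - 1 ≠ 0 := sub_ne_zero.mpr hs1
        have h3 : s * (1 - (s - 1) * fractIntegral s) = 0 := by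
          have : s / (s - 1) - s * fractIntegral s =
              s * (1 - (s - 1) * fractIntegral s) / (s - 1) := by field_simp
          rw [this] at hz
          exact (div_eq_zero_iff.mp hz.symm).resolve_right hs1'
        have h4 := (mul_eq_zero.mp h3).resolve_left hs0
        rw [eq_div_iff hs1']
        linear_combination -h4
      rw [hfi, show (1 : ℂ) - D - I * n * p = -(s - 1) by rw [hs]; ring]
      have hs1' : s - 1 ≠ 0 := sub_ne_zero.mpr hs1
      field_simp
      ring
  -- Parseval
  have hP := tsum_sq_fourierCoeffOn hab hL2
  simp only [hcoeff, norm_zero, ne_eq, OfNat.ofNat_ne_zero, not_false_eq_true, zero_pow,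
    tsum_zero] at hP
  have hint0 : ∫ x in (-(π / p))..(π / p), ‖F x‖ ^ 2 = 0 := by
    have h2b : (π / p - -(π / p))⁻¹ ≠ 0 := inv_ne_zero (by linarith)
    rw [smul_eq_mul] at hP
    exact (mul_eq_zero.mp hP.symm).resolve_left h2b
  have hFi2 : IntervalIntegrable (fun x ↦ ‖F x‖ ^ 2) volume (-(π / p)) (π / p) := by
    rw [intervalIntegrable_iff, uIoc_of_le hab.le]
    refine Integrable.mono' (integrable_const ((M + ‖c‖) ^ 2)) ?_ ?_
    · exact ((continuous_norm.measurable.comp hFm).pow_const 2).aestronglyMeasurable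
    · rw [ae_restrict_iff' measurableSet_Ioc]
      refine ae_of_all _ fun x hx ↦ ?_
      rw [Real.norm_eq_abs, abs_of_nonneg (by positivity)]
      have h0 : 0 ≤ ‖F x‖ := norm_nonneg _
      have := hF_bdd x hx
      nlinarith
  have hae := (intervalIntegral.integral_eq_zero_iff_of_le_of_nonneg_ae hab.le
    (ae_of_all _ fun x ↦ by positivity) hFi2).mp hint0
  refine ⟨c.re, ?_⟩
  filter_upwards [hae] with x hx
  have hx0 : F x = 0 := by simpa using hx
  have h1 : (Φ x : ℂ) + (Ψ x : ℂ) = c := by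
    rw [hF, hFc] at hx0; exact sub_eq_zero.mp hx0
  have := congrArg Complex.re h1
  simpa using this

/-! ### The jump at `0`: an a.e.-constant `Φ + Ψ` is impossible -/

/-- `{u} - {v} ≤ min(1, u - v)` for `v ≤ u`. [folklore] -/
private theorem fract_sub_fract_le {u v : ℝ} (h : v ≤ u) :
    Int.fract u - Int.fract v ≤ min 1 (u - v) := by
  refine le_min ?_ ?_
  · linarith [Int.fract_lt_one u, Int.fract_nonneg v]
  · rw [Int.fract, Int.fract]
    have : ((⌊v⌋ : ℤ) : ℝ) ≤ ((⌊u⌋ : ℤ) : ℝ) := by exact_mod_cast Int.floor_le_floor h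
    linarith

/-- `{u} ≤ u - 1` for `u ≥ 1`. [folklore] -/
private theorem fract_le_sub_one {u : ℝ} (h : 1 ≤ u) : Int.fract u ≤ u - 1 := by
  rw [Int.fract]
  have : (1 : ℝ) ≤ ((⌊u⌋ : ℤ) : ℝ) := by exact_mod_cast Int.le_floor.mpr (by exact_mod_cast h)
  linarith

/-- The `k = 0` term across the jump: for `-ε < y < 0 < x < ε`, `g(x) - g(y) ≤ e^ε - 1`.
[folklore] -/
private theorem g_sub_g_le {D ε x y : ℝ} (hD : 0 < D) {g : ℝ → ℝ}
    (hg : ∀ y, g y = if 0 < y then Int.fract (rexp y) * rexp (-(D * y)) else 0)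
    (hx : x ∈ Ioo 0 ε) (hy : y ∈ Ioo (-ε) 0) : g x - g y ≤ rexp ε - 1 := by
  rw [hg y, if_neg (not_lt.mpr hy.2.le), sub_zero, hg x, if_pos hx.1]
  calc Int.fract (rexp x) * rexp (-(D * x)) ≤ Int.fract (rexp x) :=
        mul_le_of_le_one_right (Int.fract_nonneg _) (Real.exp_le_one_iff.mpr (by nlinarith [hx.1]))
    _ ≤ rexp x - 1 := fract_le_sub_one (Real.one_le_exp_iff.mpr hx.1.le)
    _ ≤ rexp ε - 1 := by gcongr; exact hx.2.le

/-- The `k + 1`-st term across the jump: for `-ε < y < 0 < x < ε ≤ L`,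
`g(x + (k+1)L) - g(y + (k+1)L) ≤ e^{Dε} (e^{-DL})^{k+1} min(1, e^{(k+1)L}(e^ε - e^{-ε}))`
(monotonicity `{u} - {v} ≤ u - v` of the sawtooth between jumps). [folklore] -/
private theorem g_translate_sub_le {D L ε x y : ℝ} (hD : 0 < D) (hL : ε ≤ L) {g : ℝ → ℝ}
    (hg : ∀ y, g y = if 0 < y then Int.fract (rexp y) * rexp (-(D * y)) else 0)
    (hx : x ∈ Ioo 0 ε) (hy : y ∈ Ioo (-ε) 0) (k : ℕ) :
    g (x + (k + 1 : ℕ) * L) - g (y + (k + 1 : ℕ) * L) ≤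
      rexp (D * ε) * rexp (-(D * L)) ^ (k + 1) *
        min 1 (rexp ((k + 1 : ℕ) * L) * (rexp ε - rexp (-ε))) := by
  have hk1 : (1 : ℝ) ≤ ((k + 1 : ℕ) : ℝ) := by exact_mod_cast Nat.succ_pos k
  have hεL : ε ≤ ((k + 1 : ℕ) : ℝ) * L := by nlinarith [hy.1, hy.2]
  have hyL : 0 < y + (k + 1 : ℕ) * L := by linarith [hy.1]
  have hxL : 0 < x + (k + 1 : ℕ) * L := by linarith [hx.1, hy.2]
  rw [hg, if_pos hxL, hg, if_pos hyL]
  have hvu : rexp (y + (k + 1 : ℕ) * L) ≤ rexp (x + (k + 1 : ℕ) * L) :=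
    Real.exp_le_exp.mpr (by linarith [hx.1, hy.2])
  have hAB : rexp (-(D * (x + (k + 1 : ℕ) * L))) ≤ rexp (-(D * (y + (k + 1 : ℕ) * L))) :=
    Real.exp_le_exp.mpr (by nlinarith [hx.1, hy.2])
  have hB0 : 0 ≤ rexp (-(D * (y + (k + 1 : ℕ) * L))) := (Real.exp_pos _).le
  have hB : rexp (-(D * (y + (k + 1 : ℕ) * L))) ≤ rexp (D * ε) * rexp (-(D * L)) ^ (k + 1) := by
    rw [← Real.exp_nat_mul, ← Real.exp_add]
    refine Real.exp_le_exp.mpr ?_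
    push_cast
    nlinarith [hy.1]
  have h1 : Int.fract (rexp (x + (k + 1 : ℕ) * L)) * rexp (-(D * (x + (k + 1 : ℕ) * L))) -
      Int.fract (rexp (y + (k + 1 : ℕ) * L)) * rexp (-(D * (y + (k + 1 : ℕ) * L))) ≤
      rexp (-(D * (y + (k + 1 : ℕ) * L))) *
        (Int.fract (rexp (x + (k + 1 : ℕ) * L)) - Int.fract (rexp (y + (k + 1 : ℕ) * L))) := by
    have := mul_le_mul_of_nonneg_left hAB (Int.fract_nonneg (rexp (x + (k + 1 : ℕ) * L)))
    linarith
  have h2 : Int.fract (rexp (x + (k + 1 : ℕ) * L)) - Int.fract (rexp (y + (k + 1 : ℕ) * L)) ≤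
      min 1 (rexp ((k + 1 : ℕ) * L) * (rexp ε - rexp (-ε))) := by
    refine (fract_sub_fract_le hvu).trans (min_le_min le_rfl ?_)
    rw [Real.exp_add, Real.exp_add]
    have e1 : rexp x ≤ rexp ε := Real.exp_le_exp.mpr hx.2.le
    have e2 : rexp (-ε) ≤ rexp y := Real.exp_le_exp.mpr hy.1.le
    nlinarith [Real.exp_pos (((k + 1 : ℕ) : ℝ) * L)]
  have hm0 : 0 ≤ min 1 (rexp ((k + 1 : ℕ) * L) * (rexp ε - rexp (-ε))) :=
    le_min zero_le_one (mul_nonneg (Real.exp_pos _).le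
      (sub_nonneg.mpr (Real.exp_le_exp.mpr (by linarith [hx.1, hx.2]))))
  calc _ ≤ _ := h1
    _ ≤ rexp (-(D * (y + (k + 1 : ℕ) * L))) *
          min 1 (rexp ((k + 1 : ℕ) * L) * (rexp ε - rexp (-ε))) :=
        mul_le_mul_of_nonneg_left h2 hB0
    _ ≤ _ := mul_le_mul_of_nonneg_right hB hm0

/-- **No a.e.-constant.** `Φ + Ψ` cannot agree a.e. with a constant on the period interval:
`Ψ` jumps by `-1` at `0` while `Φ` (a sum of sawtooth translates, all jumping downwards)
cannot jump upwards — quantitatively, `Φ(x) - Φ(y) ≤ o(1)` for `y < 0 < x`, `x - y → 0`.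
[cite: Putnam1954, pp. 97–99; LapidusVanfrankenhuijsen2006, Theorem 11.1] -/
theorem not_ae_eq_const {D p : ℝ} (hD0 : 0 < D) (hD1 : D < 1) (hp : 0 < p) {g Φ Ψ : ℝ → ℝ}
    (hg : ∀ y, g y = if 0 < y then Int.fract (rexp y) * rexp (-(D * y)) else 0)
    (hΦ : ∀ x, Φ x = ∑' k : ℕ, g (x + k * (2 * π / p)))
    (hΨ : ∀ x, Ψ x = rexp ((1 - D) * x) *
      ((if x ≤ 0 then 1 else 0) + 1 / (rexp ((1 - D) * (2 * π / p)) - 1)))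
    (c : ℝ) (hae : ∀ᵐ x ∂(volume.restrict (Ioc (-(π / p)) (π / p))), Φ x + Ψ x = c) :
    False := by
  have hb0 : 0 < π / p := div_pos Real.pi_pos hp
  have hL0 : 0 < 2 * π / p := by positivity
  have hbL : π / p < 2 * π / p := by
    rw [lt_div_iff₀ hp, div_mul_cancel₀ _ hp.ne']; linarith [Real.pi_pos]
  have hC₁ := C₁_pos hD1 hp
  have hr0 : 0 ≤ rexp (-(D * (2 * π / p))) := (Real.exp_pos _).le
  have hr1 : rexp (-(D * (2 * π / p))) < 1 := Real.exp_lt_one_iff.mpr (by nlinarith)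
  -- the majorant `M ε = Σ_k r^{k+1} min(1, e^{(k+1)L}(e^ε - e^{-ε})) → 0` (Tannery)
  set M : ℝ → ℝ := fun ε ↦ ∑' k : ℕ, rexp (-(D * (2 * π / p))) ^ (k + 1) *
    min 1 (rexp ((k + 1 : ℕ) * (2 * π / p)) * (rexp ε - rexp (-ε))) with hMdef
  have hsum_r : Summable fun k : ℕ ↦ rexp (-(D * (2 * π / p))) ^ (k + 1) := by
    simp_rw [pow_succ]
    exact (summable_geometric_of_lt_one hr0 hr1).mul_right _
  have hM : Tendsto M (𝓝[>] 0) (𝓝 0) := by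
    have hab : ∀ k : ℕ, Tendsto (fun ε : ℝ ↦ rexp (-(D * (2 * π / p))) ^ (k + 1) *
        min 1 (rexp ((k + 1 : ℕ) * (2 * π / p)) * (rexp ε - rexp (-ε)))) (𝓝[>] 0) (𝓝 0) := by
      intro k
      have hcont : Continuous fun ε : ℝ ↦ rexp (-(D * (2 * π / p))) ^ (k + 1) *
          min 1 (rexp ((k + 1 : ℕ) * (2 * π / p)) * (rexp ε - rexp (-ε))) := by fun_prop
      have h := hcont.tendsto 0
      simp only [neg_zero, sub_self, mul_zero, min_eq_right (zero_le_one' ℝ)] at h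
      exact h.mono_left nhdsWithin_le_nhds
    have hbd : ∀ᶠ ε in 𝓝[>] (0:ℝ), ∀ k : ℕ, ‖rexp (-(D * (2 * π / p))) ^ (k + 1) *
        min 1 (rexp ((k + 1 : ℕ) * (2 * π / p)) * (rexp ε - rexp (-ε)))‖ ≤
        rexp (-(D * (2 * π / p))) ^ (k + 1) := by
      refine eventually_nhdsWithin_of_forall fun ε hε k ↦ ?_
      have hε' : 0 < ε := hε
      have hδ : 0 ≤ rexp ((k + 1 : ℕ) * (2 * π / p)) * (rexp ε - rexp (-ε)) :=
        mul_nonneg (Real.exp_pos _).le (sub_nonneg.mpr (Real.exp_le_exp.mpr (by linarith)))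
      rw [Real.norm_eq_abs, abs_of_nonneg (mul_nonneg (pow_nonneg hr0 _) (le_min zero_le_one hδ))]
      exact mul_le_of_le_one_right (pow_nonneg hr0 _) (min_le_left _ _)
    have h := tendsto_tsum_of_dominated_convergence
      (f := fun (ε : ℝ) (k : ℕ) ↦ rexp (-(D * (2 * π / p))) ^ (k + 1) *
        min 1 (rexp ((k + 1 : ℕ) * (2 * π / p)) * (rexp ε - rexp (-ε))))
      (g := fun _ : ℕ ↦ (0 : ℝ)) hsum_r hab hbd
    simpa [hMdef] using h
  -- the two sides of the comparison as `ε → 0⁺`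
  have hlhs : Tendsto (fun ε : ℝ ↦ (rexp ε - 1) + rexp (D * ε) * M ε) (𝓝[>] 0) (𝓝 0) := by
    have h1 : Tendsto (fun ε : ℝ ↦ (rexp ε - 1)) (𝓝[>] 0) (𝓝 0) := by
      have h := ((by fun_prop : Continuous fun ε : ℝ ↦ rexp ε - 1).tendsto (0:ℝ))
      simp only [Real.exp_zero, sub_self] at h
      exact h.mono_left nhdsWithin_le_nhds
    have h2 : Tendsto (fun ε : ℝ ↦ rexp (D * ε)) (𝓝[>] 0) (𝓝 1) := by
      have h := ((by fun_prop : Continuous fun ε : ℝ ↦ rexp (D * ε)).tendsto (0:ℝ))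
      simp only [mul_zero, Real.exp_zero] at h
      exact h.mono_left nhdsWithin_le_nhds
    simpa using h1.add (h2.mul hM)
  set R : ℝ → ℝ := fun ε ↦ rexp (-((1 - D) * ε)) -
    1 / (rexp ((1 - D) * (2 * π / p)) - 1) * (rexp ((1 - D) * ε) - rexp (-((1 - D) * ε))) with hRdef
  have hrhs : Tendsto R (𝓝[>] 0) (𝓝 1) := by
    have hcont : Continuous R := by rw [hRdef]; fun_prop
    have h := hcont.tendsto 0
    simp only [hRdef, mul_zero, neg_zero, Real.exp_zero, sub_self, mul_zero, sub_zero] at h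
    exact h.mono_left nhdsWithin_le_nhds
  -- choose `ε`
  obtain ⟨ε, hε0, hεb, hε1, hε2⟩ : ∃ ε : ℝ, 0 < ε ∧ ε < π / p ∧
      (rexp ε - 1) + rexp (D * ε) * M ε < 1 / 2 ∧ 1 / 2 < R ε := by
    have e0 : ∀ᶠ ε in 𝓝[>] (0:ℝ), 0 < ε := self_mem_nhdsWithin
    have eb : ∀ᶠ ε in 𝓝[>] (0:ℝ), ε < π / p := mem_nhdsWithin_of_mem_nhds (Iio_mem_nhds hb0)
    have e1 := (tendsto_order.1 hlhs).2 (1 / 2) (by norm_num)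
    have e2 := (tendsto_order.1 hrhs).1 (1 / 2) (by norm_num)
    obtain ⟨ε, h0, hb, h1, h2⟩ := (e0.and (eb.and (e1.and e2))).exists
    exact ⟨ε, h0, hb, h1, h2⟩
  -- good points on both sides of `0`
  have hsub1 : Ioo 0 ε ⊆ Ioc (-(π / p)) (π / p) := fun x hx ↦ ⟨by linarith [hx.1], by linarith [hx.2]⟩
  have hsub2 : Ioo (-ε) 0 ⊆ Ioc (-(π / p)) (π / p) :=
    fun y hy ↦ ⟨by linarith [hy.1], by linarith [hy.2]⟩
  have hne : ∀ {a b : ℝ}, a < b → (ae (volume.restrict (Ioo a b))).NeBot := by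
    intro a b hab
    rw [ae_neBot, Ne, Measure.restrict_eq_zero, Real.volume_Ioo, ENNReal.ofReal_eq_zero, not_le]
    linarith
  obtain ⟨x, hx, hxc⟩ : ∃ x, x ∈ Ioo 0 ε ∧ Φ x + Ψ x = c := by
    haveI := hne hε0
    exact ((ae_restrict_mem measurableSet_Ioo).and
      (ae_restrict_of_ae_restrict_of_subset hsub1 hae)).exists
  obtain ⟨y, hy, hyc⟩ : ∃ y, y ∈ Ioo (-ε) 0 ∧ Φ y + Ψ y = c := by
    haveI := hne (by linarith : -ε < 0)
    exact ((ae_restrict_mem measurableSet_Ioo).and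
      (ae_restrict_of_ae_restrict_of_subset hsub2 hae)).exists
  -- lower bound for the jump of `Ψ`
  have hΨdiff : R ε ≤ Ψ y - Ψ x := by
    rw [hΨ y, hΨ x, if_pos hy.2.le, if_neg (not_le.mpr hx.1), hRdef]
    dsimp only
    have ey : rexp (-((1 - D) * ε)) ≤ rexp ((1 - D) * y) := Real.exp_le_exp.mpr (by nlinarith [hy.1])
    have ex : rexp ((1 - D) * x) ≤ rexp ((1 - D) * ε) := Real.exp_le_exp.mpr (by nlinarith [hx.2])
    nlinarith
  -- upper bound for the variation of `Φ`
  have hΦdiff : Φ x - Φ y ≤ (rexp ε - 1) + rexp (D * ε) * M ε := by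
    have hsx := summable_g_translate hD0 hL0 hg x
    have hsy := summable_g_translate hD0 hL0 hg y
    rw [hΦ x, hΦ y, ← hsx.tsum_sub hsy, (hsx.sub hsy).tsum_eq_zero_add]
    refine add_le_add ?_ ?_
    · simpa using g_sub_g_le hD0 hg hx hy
    · rw [hMdef]; dsimp only
      rw [← tsum_mul_left]
      have hs2 : Summable fun k : ℕ ↦ rexp (D * ε) * (rexp (-(D * (2 * π / p))) ^ (k + 1) *
          min 1 (rexp ((k + 1 : ℕ) * (2 * π / p)) * (rexp ε - rexp (-ε)))) := by
        refine Summable.mul_left _ (Summable.of_nonneg_of_le (fun k ↦ ?_) (fun k ↦ ?_) hsum_r)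
        · exact mul_nonneg (pow_nonneg hr0 _) (le_min zero_le_one (mul_nonneg (Real.exp_pos _).le
            (sub_nonneg.mpr (Real.exp_le_exp.mpr (by linarith)))))
        · exact mul_le_of_le_one_right (pow_nonneg hr0 _) (min_le_left _ _)
      refine ((summable_nat_add_iff 1).mpr (hsx.sub hsy)).tsum_le_tsum (fun k ↦ ?_) hs2
      have := g_translate_sub_le hD0 (hεb.le.trans hbL.le) hg hx hy k
      simpa [mul_assoc] using this
  -- contradiction
  have heq : Φ x - Φ y = Ψ y - Ψ x := by linarith
  linarith

end Putnam1954

/-- **Putnam 1954 = Lapidus–van Frankenhuijsen 2006, Theorem 11.1: the Riemann zeta function has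
no infinite vertical arithmetic progression of zeros** — for `0 < D < 1` and `p > 0` some
`ζ(D + inp)`, `n ≠ 0`, is non-zero. Proof (Putnam's Fourier-series argument): by Titchmarsh
(2.1.4) (`riemannZeta_eq_of_re_pos`) every zero `s = D + inp` gives
`∫_0^∞ {e^y} e^{-sy} dy = 1/(s-1)`; these are the `(2π/p)`-Fourier coefficients of the
translates-sum of `{e^y}e^{-Dy}`, which therefore differs from the explicit exponential `-Ψ` by an
a.e. constant (Parseval); but `Ψ` jumps by `-1` at `0`, while a sum of downward sawtooth jumps
cannot jump upwards. [cite: LapidusVanfrankenhuijsen2006, Theorem 11.1; Putnam1954, pp. 97–99] -/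
theorem LapidusVanFrankenhuijsen2006_thm11_1_holds : LapidusVanFrankenhuijsen2006_thm11_1 := by
  intro D p hD0 hD1 hp
  by_contra hcon
  have hzero : ∀ n : ℤ, n ≠ 0 → riemannZeta (D + I * n * p) = 0 := fun n hn ↦ by
    by_contra h
    exact hcon ⟨n, hn, by rwa [show (D : ℂ) + n * p * I = D + I * n * p by ring]⟩
  obtain ⟨c, hc⟩ := Putnam1954.ae_eq_const hD0 hD1 hp
    (g := fun y ↦ if 0 < y then Int.fract (rexp y) * rexp (-(D * y)) else 0)
    (Φ := fun x ↦ ∑' k : ℕ,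
      (fun y ↦ if 0 < y then Int.fract (rexp y) * rexp (-(D * y)) else 0) (x + k * (2 * π / p)))
    (Ψ := fun x ↦ rexp ((1 - D) * x) *
      ((if x ≤ 0 then 1 else 0) + 1 / (rexp ((1 - D) * (2 * π / p)) - 1)))
    (fun _ ↦ rfl) (fun _ ↦ rfl) (fun _ ↦ rfl) hzero
  exact Putnam1954.not_ae_eq_const hD0 hD1 hp (fun _ ↦ rfl) (fun _ ↦ rfl) (fun _ ↦ rfl) c hc


end Literature.NumberTheory.LFunctions

end
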